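import Summits.SmoothPoincare4.SmoothPoincare4.Theses.EntropyRung

/-!
# Crux NoncompactShrinkerGap — ideator 1 (round 1, gen 2): first lemmas of the idea cards
`extremal-bootstrap` and `decay-or-expand`

Everything is stated over the crux binder's own vocabulary (fact-free cone of the route file):
`PseudoRiemannianMetric`, `g.edist`, `g.ricci`, `g.hessian`, `g.scalarCurvature`, `g.gradSq`,
`riemannianMeasure (g.toContMDiffRiemannianMetric hg)`, `g.leviCivita.IsFlat`.

* `Datum` — the crux hypotheses bundled (complete, connected, non-compact, non-flat normalised
  4-d gradient shrinker); `Datum.Z` — its weighted volume `∫ e^{-f} dV` (= 16π² Θ);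
  `cylBound` — the crux bound `32π²√π e^{-3/2}` (= 16π² Θ(S³×ℝ)).
* `Gap` — the crux restated over `Datum`; `gap_imp_crux : Gap → NoncompactShrinkerGap` (PROVED).
* card `cylindrical-blowdown`: `UnboundedScalarGap` (step 1: blow-ups at infinity are steady or
  split, their tangent flows at −∞ are cylinders / flat orbifolds and inherit density ≥ Θ(M)),
  `NonDecayingScalarGap` (step 2: bounded curvature + a non-decaying end ⇒ a non-flat split
  translation limit ⇒ Θ ≤ Θ(S³)), `ScalarFlatGap` (step 3: the crux in the asymptotically conical
  regime, entered through `S → 0`), and the PROVED exhaustion `crux_of_exhaustion`.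
* card `decay-or-expand`: `MaximiserExists` (E), and the composition `crux_of_decay` over an
  abstract stability predicate (the ν-second-variation vocabulary is a definition request),
  PROVED as pure logic.
-/

noncomputable section

open scoped Manifold ContDiff ENNReal NNReal
open MeasureTheory Set

namespace Summit.SmoothPoincare4.SmoothPoincare4.Cruxes.NoncompactShrinkerGap.SketchK1

open Literature.Geometry.Lorentzian

/-- Model space `ℝ⁴`. -/
abbrev E4 : Type := EuclideanSpace ℝ (Fin 4)

/-- The crux hypotheses, bundled: a complete (closed `g.edist`-balls compact), connected,
non-compact Riemannian 4-manifold with a smooth normalised gradient shrinker structure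
`Ric + Hess f = g/2`, `R + |∇f|² = f`, and `R ≢ 0` — literally the binder of
`EntropyRung.NoncompactShrinkerGap`. -/
structure Datum where
  M : Type
  [top : TopologicalSpace M]
  [t2 : T2Space M]
  [sc : SecondCountableTopology M]
  [cs : ChartedSpace E4 M]
  [mfd : IsManifold (𝓡 4) ∞ M]
  [conn : ConnectedSpace M]
  [nc : NoncompactSpace M]
  [t3 : T3Space M]
  [ms : MeasurableSpace M]
  [bs : BorelSpace M]
  g : PseudoRiemannianMetric (𝓡 4) ∞ E4 (TangentSpace (𝓡 4) : M → Type _)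
  [lc : g.HasLeviCivita]
  f : M → ℝ
  hg : g.IsRiemannian
  complete : ∀ (x : M) (r : NNReal), IsCompact {y : M | g.edist hg x y ≤ r}
  smooth : ContMDiff (𝓡 4) 𝓘(ℝ, ℝ) ∞ f
  soliton : ∀ (x : M) (X Y : TangentSpace (𝓡 4) x),
    g.ricci x X Y + g.hessian f x X Y = (1 / 2 : ℝ) * g.val x X Y
  normalised : ∀ x : M, g.scalarCurvature x + g.gradSq f x = f x
  nonflat : ∃ x : M, g.scalarCurvature x ≠ 0

attribute [instance] Datum.top Datum.t2 Datum.sc Datum.cs Datum.mfd Datum.conn Datum.nc Datum.t3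
  Datum.ms Datum.bs Datum.lc

/-- Weighted volume `Z(D) = ∫_M e^{-f} dV ∈ [0, ∞]` (so that `Θ = Z / 16π²`). -/
def Datum.Z (D : Datum) : ℝ≥0∞ :=
  ∫⁻ x, ENNReal.ofReal (Real.exp (-D.f x)) ∂(riemannianMeasure (D.g.toContMDiffRiemannianMetric D.hg))

/-- The crux bound `16π² Θ(S³ × ℝ) = 32 π² √π e^{-3/2} ≈ 124.9`. -/
def cylBound : ℝ≥0∞ :=
  ENNReal.ofReal (32 * Real.pi ^ 2 * Real.sqrt Real.pi * Real.exp (-(3 : ℝ) / 2))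

/-- The crux over bundled data. -/
def Gap : Prop := ∀ D : Datum, D.Z ≤ cylBound

/-- Unbundling: `Gap` is (one direction of) the crux `EntropyRung.NoncompactShrinkerGap`. -/
theorem gap_imp_crux (h : Gap) :
    Summit.SmoothPoincare4.SmoothPoincare4.Theses.EntropyRung.NoncompactShrinkerGap := by
  intro M _ _ _ _ _ _ _ _ _ _ g _ f hg hc hf hsol hnorm hnf
  exact h { M := M, g := g, f := f, hg := hg, complete := hc, smooth := hf, soliton := hsol,
            normalised := hnorm, nonflat := hnf }

/-- Bundling: the converse direction. -/
theorem crux_imp_gap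
    (h : Summit.SmoothPoincare4.SmoothPoincare4.Theses.EntropyRung.NoncompactShrinkerGap) : Gap := by
  intro D
  exact h D.M D.g D.f D.hg D.complete D.smooth D.soliton D.normalised D.nonflat

/-! ### Card `cylindrical-blowdown` -/

/-- Scalar curvature tends to `0` at infinity (every super-level set `{S ≥ ε}` is contained in a
compact set). By Munteanu–Wang (arXiv:1410.3813 + arXiv:1412.4414) this makes a 4-d shrinker
asymptotically conical with bounded curvature. -/
def Datum.ScalarFlatAtInfinity (D : Datum) : Prop :=
  ∀ ε : ℝ, 0 < ε → ∃ K : Set D.M, IsCompact K ∧ ∀ x, x ∉ K → D.g.scalarCurvature x < ε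

/-- Globally bounded scalar curvature (⇒ `|Rm| ≤ c S` bounded, Munteanu–Wang 2015). -/
def Datum.ScalarBounded (D : Datum) : Prop := ∃ C : ℝ, ∀ x : D.M, D.g.scalarCurvature x ≤ C

/-- **Step 1 (the lever): unbounded curvature is sub-cylindrical.** If `S` is unbounded, point-pick
`x_k → ∞` with `λ_k := S(x_k) → ∞`; the flows induced by `(M, λ_k g)` based at `(x_k, 0)`
F-subconverge (Li–Wang heat kernel II, arXiv:2301.08430 §6; Bertellotti–Buzano arXiv:2508.10790
Thms 1.2–1.3) to a non-flat limit `X` with Nash entropy `≥ log Θ(M)` everywhere, which is a STEADY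
gradient soliton (`Hess F_k = g_k/2λ_k − Ric → −Ric`) or splits a line (`|∇F_k| → ∞`); by the
Bamler–Chow–Deng–Ma–Zhang argument (arXiv:2102.04649 Prop 4) its tangent flow at `−∞` is
`ℝ⁴/Γ (Γ ≠ 1)`, `(S³/Γ)×ℝ`, `S²×ℝ²` or `((S²×ℝ)/ℤ₂)×ℝ`, all of density `≤ Θ(S³×ℝ)`, and that density
is `e^{lim N} ≥ Θ(M)`. -/
def UnboundedScalarGap : Prop := ∀ D : Datum, ¬ D.ScalarBounded → D.Z ≤ cylBound

/-- **Step 2: a bounded-curvature end on which `S ↛ 0` is sub-cylindrical.** With `S` (hence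
`Rm`, Munteanu–Wang 2015) bounded, a divergent sequence with `S(x_k) ≥ c > 0` has a smooth pointed
Cheeger–Gromov sublimit which is a non-flat shrinker splitting a line, `N³ × ℝ` with
`N ∈ {S³/Γ, S²×ℝ, (S²×ℝ)/ℤ₂}` (Munteanu–Wang arXiv:1606.01861; Bertellotti–Buzano Thm 1.8), and
`log Θ(M) = μ(g,1) ≤ μ(N×ℝ, 1) = log Θ(N)` by transplanting the cylinder's minimiser
(Carrillo–Ni / `CarrilloNi2009_shrinkerLSI`): `Θ(M) ≤ Θ(S³) = Θ(S³×ℝ)`. -/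
def NonDecayingScalarGap : Prop :=
  ∀ D : Datum, D.ScalarBounded → ¬ D.ScalarFlatAtInfinity → D.Z ≤ cylBound

/-- **Step 3 (AC GAP): the crux in the asymptotically conical regime**, entered through `S → 0`
at infinity (⇒ `|Rm| ≤ cS` bounded, Munteanu–Wang 2015; ⇒ smoothly asymptotic to a cone,
Munteanu–Wang 2017). This is the residual open core shared with cards `cone-entropy-ceiling` and
`level-set-entropic-necks`; it is a SPECIAL CASE of the crux, hence weaker. -/
def ScalarFlatGap : Prop :=
  ∀ D : Datum, D.ScalarFlatAtInfinity → D.Z ≤ cylBound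

/-- **Exhaustion of card `cylindrical-blowdown` (PROVED, pure logic):**
crux ⇐ Step 1 ∧ Step 2 ∧ Step 3. -/
theorem crux_of_exhaustion (h₁ : UnboundedScalarGap) (h₂ : NonDecayingScalarGap)
    (h₃ : ScalarFlatGap) :
    Summit.SmoothPoincare4.SmoothPoincare4.Theses.EntropyRung.NoncompactShrinkerGap := by
  refine gap_imp_crux fun D ↦ ?_
  by_cases hb : D.ScalarBounded
  · by_cases hf : D.ScalarFlatAtInfinity
    · exact h₃ D hf
    · exact h₂ D hb hf
  · exact h₁ D hb

/-! ### Card `decay-or-expand` -/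

/-- `D` maximises the weighted volume (equivalently the Gaussian density `Θ`) among all data of
the crux class. -/
def Datum.IsMaximiser (D : Datum) : Prop := ∀ D' : Datum, D'.Z ≤ D.Z

/-- **(E) Existence of a densest non-compact shrinker.** The supremum of `Θ` over complete
non-compact non-flat normalised 4-d gradient shrinkers is attained. Intended proof: a maximising
sequence has `μ = log Θ ≥ log Θ(S³×ℝ) − 1`, so Li–Li–Wang weak compactness (arXiv:1809.04049 Thm 1.1;
4-d orbifold version Haslhofer–Müller arXiv:1407.1683) gives a pointed limit conifold shrinker, and
LLW Thm 1.2(c) (`∫ e^{-f}` is continuous in the limit) transfers the value; the limit is non-compact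
(pointed limit of unbounded length spaces), non-flat (Li–Wang gap μ ≤ −δ₀), and SMOOTH because an
orbifold point of order `|Γ| ≥ 2` forces `Θ ≤ 1/|Γ| ≤ 1/2 < Θ(S³×ℝ)` (ν ≤ lim_{τ→0} μ(g,τ) at the
point = μ(ℝ⁴/Γ) = −log|Γ|). If the class is empty the crux is vacuous; we state (E) as an
implication from non-emptiness. -/
def MaximiserExists : Prop := Nonempty Datum → ∃ D : Datum, D.IsMaximiser


/-- **(TERMINUS) the densest non-compact shrinker is ν-stable (or upward-immortal)**, over an
abstract predicate `Stable : Datum → Prop` standing for "ν-linearly stable OR every compactly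
supported ν-increasing perturbation has an immortal complete Ricci flow" — the ν-second-variation
/ Ricci-flow-of-a-perturbation vocabulary is a definition request (Cao–Zhu arXiv:1008.0842 Thm 1.1:
`δ²ν(h,h) = τ(4πτ)^{-n/2} ∫⟨N̂h,h⟩e^{-f}`). Mechanism: an unstable maximiser is pushed to
`ν(g + sh) > log Θ*` (CHI 2004 §4 'decay'); if the perturbed complete flow is singular, every
singularity model is a NON-COMPACT (compact model ⇒ M compact), SMOOTH (orbifold ⇒ Θ ≤ ½), denser
(`Θ ≥ e^{ν} > Θ*`) shrinker — impossible at a maximiser. -/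
def DecayTerminus (Stable : Datum → Prop) : Prop :=
  ∀ D : Datum, D.IsMaximiser → cylBound < D.Z → Stable D

/-- **(STABLE GAP)** the crux for ν-stable-or-upward-immortal shrinkers: the Ricci-flow analogue
of Colding–Minicozzi's F-stable classification / Bernstein–Wang's immortal-branch topology,
restricted to the density form (FIK is conjecturally stable but has Θ = .672). -/
def StableGap (Stable : Datum → Prop) : Prop := ∀ D : Datum, Stable D → D.Z ≤ cylBound

/-- **Composition of card `decay-or-expand` (PROVED, pure logic).** -/
theorem crux_of_decay (Stable : Datum → Prop) (hE : MaximiserExists)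
    (hT : DecayTerminus Stable) (hS : StableGap Stable) :
    Summit.SmoothPoincare4.SmoothPoincare4.Theses.EntropyRung.NoncompactShrinkerGap := by
  refine gap_imp_crux fun D ↦ ?_
  obtain ⟨Dmax, hmax⟩ := hE ⟨D⟩
  have hDmax : Dmax.Z ≤ cylBound := by
    by_contra hlt
    exact hlt (hS Dmax (hT Dmax hmax (lt_of_not_ge hlt)))
  exact (hmax D).trans hDmax

end Summit.SmoothPoincare4.SmoothPoincare4.Cruxes.NoncompactShrinkerGap.SketchK1

end
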